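import Summits.AnomalousDissipation.AnomalousDissipation.Theses.ImpulseGrid
import Summits.AnomalousDissipation.AnomalousDissipation.Theorems.MarginalStabilityChainChainRealisationStubLoudOfContrast
import Literature.Analysis.FluidPDE.TorusClassicalLerayHopfProofs
import Literature.Analysis.FunctionSpaces.TorusClassicalNSGluing
import Literature.Analysis.FluidPDE.LongTimeAverageSubadditive
import HarnessLib

/-!
# `ImpulseGrid.BoundedEnergyNoLeakGrid` from bounded-mean-energy regular drift families:
# the sorry-free reduction (crux stmt-AnomalousDissipation-14350, line `Sketch`)

Support file for the crux `Summit.AnomalousDissipation.AnomalousDissipation.Theses.ImpulseGrid.BoundedEnergyNoLeakGrid`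
(item stmt-AnomalousDissipation-14350, route ImpulseGrid).  It records, as ONE implication with the hypothesis
written out (no definition is introduced), the composition of the registered skeleton of the line `Sketch`
(`Cruxes/BoundedEnergyNoLeakGrid/Lines/Sketch.lean`, v4):

  `boundedEnergyNoLeakGrid_of_regularDriftStates : RegularDriftStates → BoundedEnergyNoLeakGrid`,

where `RegularDriftStates` — the registered residual stub `stub_regularDriftStatesExist` of the line, and the
hypothesis of the transfer `RegularDriftStatesSuffice` shared by all three idea cards of the crux — says: for EVERY
grid design `(Φ, G, c)` (the ten design clauses of the crux, verbatim) there are `ν_j → 0⁺` and ETERNAL CLASSICAL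
solutions `(u_j, p_j)` of the Navier–Stokes system on `ℝ × T³` forced by the steady force `Φ • G`, with drift
datum `∫ u_j(0) = c e₀`, a per-`j` forward kinetic-energy cap, and `j`-uniformly bounded mean energy.  So the crux
closes the moment that statement is proved (by any line), exactly as the sibling crux `BoundedEnergyGrid` closes
from the planar steady branch (`ImpulseGridBoundedEnergyGridOfPlanar`).  The proof is bookkeeping: a classical
solution on `univ` is a global Leray–Hopf solution from its own time-zero slice
(`Torus.IsClassicalNSSolutionOn.isGlobalLerayHopf`, Robinson–Rodrigo–Sadowski 2016 Thm. 6.5), and under a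
forward `L²` cap the exact energy equality of classical solutions gives mean energy EQUALITY
`⟨ν‖∇u‖²⟩ = ⟨(f, u)⟩` (the in-tree budget identity
`ChainRealisation.SeparatrixFluxPinning.meanDissipation_eq_longTimeAvgSup_inner`, Doering–Foias 2002 §2), in
particular no Leray–Hopf leakage.

The file also records the DOOR from the earlier, stronger residual form (a `j`-UNIFORM forward cap, the v1
transfer target of the line) into `RegularDriftStates` at a fixed design
(`regularDriftStates_of_uniformCap`: mean energy `≤ 2E` under the cap `E`, `longTimeAvgSup_le_const`).

Status of the hypothesis (why this is a reduction and not a proof): at the admissible design `Φ ≡ 1` the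
Galilean boost `x ↦ x − ct e₀` turns `RegularDriftStates` into the existence, for the FIXED steady columnar force
`G`, of vanishing-viscosity families of eternal regular solutions with zero momentum and `ν`-uniformly bounded mean
energy — the `ν`-uniform energy problem at fixed force (Foias–Manley–Rosa–Temam 2001 (13.11): known bounds
`∝ ν⁻²`; Doering–Foias 2002 §3; the steady version is listed as open in Constantin–Tarfulea–Vicol 2014, p. 3).
No definitions, no named facts, standard axioms.
-/

-- `Summit.<Summit>.<Problem>` is the tree's mandated summit-side namespace (CONVENTIONS §2); for this
-- single-conjunct summit the two coincide, so the duplicate is deliberate.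
set_option linter.dupNamespace false

noncomputable section

open MeasureTheory Filter Set
open scoped InnerProductSpace
open Literature.Analysis.FunctionSpaces Literature.Analysis.FunctionSpaces.Torus
open Literature.Analysis.FluidPDE Literature.Analysis.FluidPDE.Torus
open Summit.AnomalousDissipation.AnomalousDissipation.Theorems.ChainRealisation.SeparatrixFluxPinning

namespace Summit.AnomalousDissipation.AnomalousDissipation.Theorems

namespace BoundedEnergyNoLeakGridReduction

variable {d : Type*} [Fintype d] [DecidableEq d]

omit [DecidableEq d] in
/-- Mean energy under a forward kinetic-energy cap: `⟨‖u‖₂²⟩ ≤ 2E` whenever `kineticEnergy (u t) ≤ E` for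
all `t ≥ 0` (`∫‖u(t)‖² = 2·kineticEnergy (u t)` and `longTimeAvgSup_le_const`; private twin of the landed
`BoundedEnergyNoLeakGrid.meanEnergy_le_of_kineticEnergy_le`, kept private so that this file's import closure
consists of modules the farm has already built). [folklore] -/
private theorem meanEnergy_le_two_mul_of_cap {u : ℝ → UnitAddTorus d → EuclideanSpace ℝ d} {E : ℝ}
    (hE : ∀ t : ℝ, 0 ≤ t → kineticEnergy (u t) ≤ E) : meanEnergy u ≤ 2 * E := by
  rw [meanEnergy_eq_longTimeAvgSup]
  refine longTimeAvgSup_le_const (fun t => integral_nonneg fun _ => sq_nonneg _) fun t ht => ?_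
  have h1 := hE t ht.le
  unfold kineticEnergy at h1
  linarith

/-- **No Leray–Hopf leakage for an eternal classical solution with a forward energy cap** (indeed mean
energy equality): `limsup_T T⁻¹∫₀ᵀ ∫⟪f, u(t)⟫ dt ≤ ⟨ν‖∇u‖₂²⟩` for a classical solution of the forced
Navier–Stokes system on all of `ℝ × T^d` with a steady smooth force `f` and `kineticEnergy (u t) ≤ C` for
`t ≥ 0` (the budget identity `meanDissipation_eq_longTimeAvgSup_inner` on the time set `[0, ∞)`,
`Torus.IsClassicalNSSolutionOn.mono`, with the `L²` cap `∫‖u(t)‖² = 2·kineticEnergy (u t) ≤ 2C`; private twin of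
the landed `BoundedEnergyNoLeakGrid.longTimeAvgSup_inner_le_meanDissipation_of_kineticEnergy_le`). [folklore] -/
private theorem noLeak_of_cap {ν : ℝ} {f : UnitAddTorus d → EuclideanSpace ℝ d}
    {u : ℝ → UnitAddTorus d → EuclideanSpace ℝ d} {p : ℝ → UnitAddTorus d → ℝ}
    (h : IsClassicalNSSolutionOn univ ν (fun _ => f) u p) (hf : IsSmooth f)
    {C : ℝ} (hC : ∀ t : ℝ, 0 ≤ t → kineticEnergy (u t) ≤ C) :
    longTimeAvgSup (fun t => ∫ x, ⟪f x, u t x⟫_ℝ) ≤ meanDissipation ν u := by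
  have hC' : ∀ t : ℝ, 0 ≤ t → ∫ x, ‖u t x‖ ^ 2 ≤ 2 * C := fun t ht => by
    have h1 := hC t ht
    unfold kineticEnergy at h1
    linarith
  exact (meanDissipation_eq_longTimeAvgSup_inner (h.mono (subset_univ _) (uniqueDiffOn_Ici 0)) hf hC').symm.le

end BoundedEnergyNoLeakGridReduction

open BoundedEnergyNoLeakGridReduction

/-- **Door** (uniform cap ⇒ regular drift family, at a fixed force and drift): a vanishing-viscosity family
of eternal classical solutions forced by `F` with drift datum `∫ u_j 0 = V` and a `j`-UNIFORM forward
kinetic-energy cap `E` is in particular a family with per-`j` caps and mean energies `≤ 2E`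
(`meanEnergy_le_two_mul_of_cap`). [folklore] -/
theorem regularDriftStates_of_uniformCap {F : UnitAddTorus (Fin 3) → EuclideanSpace ℝ (Fin 3)}
    {V : EuclideanSpace ℝ (Fin 3)}
    (h : ∃ (ν : ℕ → ℝ) (u : ℕ → ℝ → UnitAddTorus (Fin 3) → EuclideanSpace ℝ (Fin 3))
        (p : ℕ → ℝ → UnitAddTorus (Fin 3) → ℝ) (E : ℝ),
      (∀ j, 0 < ν j) ∧ Tendsto ν atTop (nhds 0) ∧
      (∀ j, IsClassicalNSSolutionOn Set.univ (ν j) (fun _ => F) (u j) (p j)) ∧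
      (∀ j, ∫ x, u j 0 x = V) ∧
      (∀ j t, 0 ≤ t → kineticEnergy (u j t) ≤ E)) :
    ∃ (ν : ℕ → ℝ) (u : ℕ → ℝ → UnitAddTorus (Fin 3) → EuclideanSpace ℝ (Fin 3))
        (p : ℕ → ℝ → UnitAddTorus (Fin 3) → ℝ),
      (∀ j, 0 < ν j) ∧ Tendsto ν atTop (nhds 0) ∧
      (∀ j, IsClassicalNSSolutionOn Set.univ (ν j) (fun _ => F) (u j) (p j)) ∧
      (∀ j, ∫ x, u j 0 x = V) ∧
      (∀ j, ∃ C : ℝ, ∀ t : ℝ, 0 ≤ t → kineticEnergy (u j t) ≤ C) ∧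
      (∃ E : ℝ, ∀ j, meanEnergy (u j) ≤ E) := by
  obtain ⟨ν, u, p, E, hν, hν0, hcl, hdat, hE⟩ := h
  exact ⟨ν, u, p, hν, hν0, hcl, hdat, fun j => ⟨E, hE j⟩,
    ⟨2 * E, fun j => meanEnergy_le_two_mul_of_cap (hE j)⟩⟩

/-- **`BoundedEnergyNoLeakGrid` from bounded-mean-energy regular drift families** (the composition of the
registered skeleton of the line `Sketch`, crux stmt-AnomalousDissipation-14350, with its residual stub as the
hypothesis, written out).  If for every grid design `(Φ, G, c)` there are `ν_j → 0⁺` and eternal classical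
solutions `(u_j, p_j)` of `NS_{ν_j}(Φ • G)` on `ℝ × T³` with drift datum `∫ u_j 0 = c e₀`, a per-`j` forward
kinetic-energy cap and `j`-uniformly bounded mean energy, then `ImpulseGrid.BoundedEnergyNoLeakGrid` holds:
with `u₀ j := u_j 0`, global Leray–Hopf is `Torus.IsClassicalNSSolutionOn.isGlobalLerayHopf`, the cap, the
datum and the mean-energy bound are copied, and no leakage is `noLeak_of_cap`.  Of the ten design hypotheses
only the smoothness of `Φ • G` is used. [folklore] -/
theorem boundedEnergyNoLeakGrid_of_regularDriftStates :
    (∀ (Φ : UnitAddTorus (Fin 3) → ℝ) (G : UnitAddTorus (Fin 3) → EuclideanSpace ℝ (Fin 3)) (c : ℝ),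
      IsSmooth Φ → IsSmooth G →
      (∀ (s : UnitAddCircle) x, Φ (x + Pi.single (1 : Fin 3) s) = Φ x ∧ Φ (x + Pi.single (2 : Fin 3) s) = Φ x) →
      (∫ x, Φ x = 1) → (∀ (s : UnitAddCircle) x, G (x + Pi.single (0 : Fin 3) s) = G x) → (∀ x, G x 0 = 0) →
      IsSmooth (fun x => Φ x • G x) → IsDivFree (fun x => Φ x • G x) → HasZeroMean (fun x => Φ x • G x) →
      0 < c →
      ∃ (ν : ℕ → ℝ) (u : ℕ → ℝ → UnitAddTorus (Fin 3) → EuclideanSpace ℝ (Fin 3))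
          (p : ℕ → ℝ → UnitAddTorus (Fin 3) → ℝ),
        (∀ j, 0 < ν j) ∧ Tendsto ν atTop (nhds 0) ∧
        (∀ j, IsClassicalNSSolutionOn Set.univ (ν j) (fun _ => fun x => Φ x • G x) (u j) (p j)) ∧
        (∀ j, ∫ x, u j 0 x = c • EuclideanSpace.single (0 : Fin 3) (1 : ℝ)) ∧
        (∀ j, ∃ C : ℝ, ∀ t : ℝ, 0 ≤ t → kineticEnergy (u j t) ≤ C) ∧
        (∃ E : ℝ, ∀ j, meanEnergy (u j) ≤ E)) →
    Summit.AnomalousDissipation.AnomalousDissipation.Theses.ImpulseGrid.BoundedEnergyNoLeakGrid := by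
  intro hR Φ G c h1 h2 h3 h4 h5 h6 hfs h8 h9 h10
  obtain ⟨ν, u, p, hν, hν0, hcl, hdat, hcap, hE⟩ := hR Φ G c h1 h2 h3 h4 h5 h6 hfs h8 h9 h10
  refine ⟨ν, fun j => u j 0, u, hν, hν0, fun j => (hcl j).isGlobalLerayHopf, hcap, hdat, hE, fun j => ?_⟩
  obtain ⟨C, hC⟩ := hcap j
  exact noLeak_of_cap (hcl j) hfs hC

end Summit.AnomalousDissipation.AnomalousDissipation.Theorems

end
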